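import Summits.BirchSwinnertonDyer.BirchSwinnertonDyer.Theorems.QuadraticBranchSignedControlPlusEtaLowerInclusionFunctionalEquationSqueeze
import Summits.BirchSwinnertonDyer.BirchSwinnertonDyer.Theorems.QuadraticBranchSignedControlPlusEtaR1HeightRows01
import HarnessLib

/-!
# Route `QuadraticBranchSignedControl` (rung K8, cell `bsd-potss`), crux `PlusEtaLowerInclusion`
# (item stmt-BirchSwinnertonDyer-19601): the residue row `69150v1` BY THE FUNCTIONAL-EQUATION SQUEEZE —
# (E⁺_η) ∧ (C1⁺_η) at `p = 5` for every tower-onto good supersingular twist of `W = 69150v1` from the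
# named facts + the kernel Tamagawa certificate + ONE displayed analytic shape; NO height index
# (seat `bsd-potss-k8eta-c1` g11; `--supports` 19601)

WHAT. `69150v1` (`[1,0,0,−13263,613017]`, additive `I₀*` at `5`, Tamagawa-`5` primes `2:5, 3:10`, `r = 1`)
is the ONE residue row of crux 19601's 40-row tower-onto census (g3–g10): `v_an = 2` while every
level-zero instrument certifies only `v_alg ≥ a = 1` (Tamagawa road, p515151/p517313), the second factor
of `p` being a height index (`b = 1`: g10's η-height instrument, kit j302973, under the η-analogue of
Castella's leading-term formula — NOT in print; record p615988 `etaPair_r1_v69150v1_5_of_heightIndexDvd`).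
THIS FILE records the row through the FUNCTIONAL-EQUATION SQUEEZE (companion road file
`…PlusEtaLowerInclusionFunctionalEquationSqueeze`, this seat): `L_5⁺(V,η,X) = u·X·(X − c₁)(X − c₂)` with
`c₁, c₂ ∈ 5ℤ_5 ∖ {0}` (kit j304242 `feshape`: PARI overconvergent modular symbols, `μ = 0`, `λ = 3 = r + 2`,
the cofactor's reduced quadratic is `S² + 1 ≡ (S−2)(S+2) (mod 5)`, two SIMPLE roots, so by Hensel
`c₁ ≡ 10`, `c₂ ≡ 15 (mod 25)`: two `ℚ_5`-rational non-classical zeros swapped by `s ↦ −s`; independent of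
the half-logarithm convention; `λ⁺ = 3, μ⁺ = 0` also from PARI's `ellpadiclambdamu`), and then the ONE
factor of `p` of the Tamagawa road (`1 + r ≤ ord₅ c₂ + ord₅ c₃ = 2`, IN THE KERNEL from
`PlusEtaR1HeightRows.rowCheck_v69150v1`) suffices: B. D. Kim's functional equation at `η` forbids
`Char X_η` from seeing only one of the two zeros.

§1 the record SHAPE (two Tamagawa-`p` primes with `p ∥ c`, `rank W ≤ 1`, the analytic split shape; the
torsion slot `a = 1` filled by p515151 §1); §2 the row.

HONEST FRAMING (cell `bsd-potss`, run/shared/lean/pub/bsd-potss/; FULL-BSD rank ≤ 1 programme, HUMAN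
RULING D-0036/D-0074): a per-row instance, CONDITIONAL on the named Literature facts in hypothesis
position (Kobayashi 2003 Thm. 1.2/1.3/2.2η/4.1η, Kitajima–Otsuki 2018 Thm. 1.3η, B. D. Kim 2008 Thm. 3.11η
— ONE MORE than the sibling records —, Milne I.4.10) and on DISPLAYED per-row data (`rank W(ℚ) ≤ 1`; on
the twist `V`: tower onto, the `V`-certificate, the analytic split shape at the Mordell–Weil rank of the
partner). The class-wide crux 19601 stays OPEN; nothing is booked; `BSD(W,5)` is NOT claimed; the census
bookkeeping of the cell (39/40 → 40/40 modulo named facts + displayed data) is a statement about evidence,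
not about the crux. No definition, no named fact, no `sorry`, axioms standard.

References: [KimBD2008MRL] Thm. 3.11 (p. 93); [Kobayashi2003] §4 Even MC + Thm. 4.1 (p. 8), Thm. 2.2
(p. 5), Thm. 9.3; [KitajimaOtsuki2018] Thm. 1.3; [MilneADT2006] I Thm. 4.10; [SilvermanATAEC1994] IV.9.4;
[Cremona1997] Table 1 (label 69150v1); [Washington1997] §7.1, §13.2.
-/

set_option autoImplicit false
set_option linter.dupNamespace false

noncomputable section

open scoped Classical

open CongruenceSubgroup Field WeierstrassCurve NumberField IsDedekindDomain
open Literature.NumberTheory.EllipticCurves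
open Literature.NumberTheory.EllipticCurves.ModularForms
open Literature.NumberTheory.GaloisRepresentations
open Literature.NumberTheory.GaloisCohomology
open Summit.BirchSwinnertonDyer.Rank1Residual.Additive
open Summit.BirchSwinnertonDyer.BirchSwinnertonDyer.Rank2Observatory.Tam
open Summit.BirchSwinnertonDyer.BirchSwinnertonDyer.Rank1Residual.X11RankOne

namespace Summit.BirchSwinnertonDyer.BirchSwinnertonDyer.Theorems

/-! ## §1 The record shape: two Tamagawa-`p` primes + the analytic split shape (no height index) -/

section Shape

variable {p : ℕ} [hp : Fact p.Prime]

/-- **RECORD SHAPE — (E⁺_η) ∧ (C1⁺_η) on a two-Tamagawa-prime row by the functional-equation squeeze.**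
GRANTED the named facts (Kobayashi 1.2/1.3/2.2η/4.1η, Kitajima–Otsuki 1.3η, B. D. Kim 3.11η, Poitou–Tate),
`p ≥ 5`, an integer equation `W₀` with a PASSING ROW CERTIFICATE `Es` and a list `L` of TWO listed primes
`≠ p` carrying the exact certified values `c` with `p ∥ c`, every other listed prime `≠ p` having certified
values prime to `p`, `W = W₀ ⊗ ℚ` globally minimal with `rank W(ℚ) ≤ 1` (DISPLAYED): for every globally
minimal `V` with `C • W^{(p*)} = V`, good at `p`, `a_p(V) = 0`, `ρ_{V,p^m}` onto, the `V`-certificate and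
the ANALYTIC SPLIT SHAPE `L_p⁺(V,η,T) = u·T^r·(T−c₁)(T−c₂)` (`c_i ∈ pℤ_p ∖ {0}`, `r = rank W`):
**(E⁺_η)(V,p) ∧ (C1⁺_η)(V,p)** (road §2 with `T = pl(L)`, `1 + r ≤ 2`). CONDITIONAL; closes nothing
class-wide. [cite: KimBD2008MRL, Thm. 3.11 (p. 93)]
[cite: Kobayashi2003, Thm. 2.2 (p. 5), §4 Even main conjecture and Thm. 4.1 (p. 8)]
[cite: KitajimaOtsuki2018, Thm. 1.3] [cite: MilneADT2006, Ch. I, Thm. 4.10] [cite: SilvermanATAEC1994, IV.9.4] -/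
theorem etaPair_of_rowCheck_of_tamagawaPair_of_feShape
    (h12 : Kobayashi2003.thm12_signedSelmerDual_finite_torsion)
    (h13 : Kobayashi2003.thm41_signedCharIdeal_divisibility)
    (h22 : Kobayashi2003.thm22_etaSignedSelmerDual_finite_torsion)
    (h41 : Kobayashi2003.thm41_plusEtaCharIdeal_dvd)
    (hKO : KitajimaOtsuki2018.mainThm13_etaSignedSelmerDual_noFiniteSubmodule)
    (hFE : Kim2008.thm311_etaSignedSelmerDual_charIdeal_map_invol)
    (hPT : poitouTate_selmerStructure_duality_real ℚ) (hp5 : 5 ≤ p)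
    {Es : List TamLocal} {W₀ : WeierstrassCurve ℤ} (hrow : TamLocal.rowCheck Es W₀ = true)
    (L : List ℕ) (hout : ∀ E ∈ Es, E.p ∉ L → E.p = p ∨ ∀ c ∈ E.vals, ¬ p ∣ c)
    (hin : ∀ E ∈ Es, E.p ∈ L → E.vals = [E.c] ∧ p ∣ E.c ∧ ¬ p ^ 2 ∣ E.c)
    (hL : ∀ ℓ ∈ L, ℓ ∈ Es.map (·.p)) (hnd : L.Nodup) (hpL : p ∉ L) (hlen : L.length = 2)
    [(W₀.baseChange ℚ).IsElliptic] [hGM : (W₀.baseChange ℚ).IsGloballyMinimal]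
    (hrW : (W₀.baseChange ℚ).mordellWeilRank ≤ 1)
    (V : WeierstrassCurve ℚ) [V.IsElliptic] [V.IsGloballyMinimal] (C : VariableChange ℚ)
    (hCV : C • (W₀.baseChange ℚ).quadraticTwist ((-1) ^ (p / 2) * p) = V)
    (hgood : V.HasGoodReductionAtPrime p) (hap : V.frobeniusTrace p = 0)
    (hsurj : ∀ m : ℕ, V.HasSurjectiveModNGaloisRep (p ^ m : ℕ))
    (hcertV : ∀ {N : ℕ} [NeZero N] (f : CuspForm (Gamma0 N) 2), IsNewformOf V f →
      ∃ L : IwasawaAlgebra p, Kobayashi2003.IsSignedPAdicLFunction f p 1 L ∧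
        IsUnit (PowerSeries.coeff V.mordellWeilRank L))
    (hshape : ∀ {N : ℕ} [NeZero N] {f : CuspForm (Gamma0 N) 2}, IsNewformOf V f →
      ∀ (ϖ : ℚ), (if Even (p / 2) then (ϖ : ℝ) * V.realPeriodRat = plusPeriod f
          else (ϖ : ℝ) * V.imaginaryPeriodRat = minusPeriod f) →
      ∀ (Lη : IwasawaAlgebra p), IsQuadraticBranchPlusLFunction f p ϖ Lη →
        ∃ (u : IwasawaAlgebra p) (c₁ c₂ : ℤ_[p]), IsUnit u ∧ (p : ℤ_[p]) ∣ c₁ ∧ (p : ℤ_[p]) ∣ c₂ ∧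
          c₁ ≠ 0 ∧ c₂ ≠ 0 ∧
          Lη = u * PowerSeries.X ^ (V.quadraticTwist ((-1) ^ (p / 2) * p)).mordellWeilRank *
            ((PowerSeries.X - PowerSeries.C c₁) * (PowerSeries.X - PowerSeries.C c₂))) :
    QuadraticBranchPlusEtaLowerInclusionAt V p ∧ QuadraticBranchPlusEtaMainConjectureAt V p := by
  obtain ⟨hpT, hT, hT1, hsum⟩ := TamagawaRoad.tamagawa_inputs_of_rowCheck hrow hGM p L hout hin hL hnd hpL
  have hd : ((-1 : ℚ) ^ (p / 2) * p) ≠ 0 :=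
    mul_ne_zero (pow_ne_zero _ (by norm_num)) (Nat.cast_ne_zero.mpr hp.out.ne_zero)
  have hr : (V.quadraticTwist ((-1) ^ (p / 2) * p)).mordellWeilRank ≤ 1 := by
    rw [TamagawaRoad.mordellWeilRank_quadraticTwist_eq_of_smul_quadraticTwist_eq hd hCV]
    exact hrW
  rw [TamagawaRoad.pl_eq_primesEquiv_symm p] at hpT hT
  exact quadraticBranchPlusEta_pair_of_namedFacts_of_invol_of_poitouTate_of_tamagawa_of_feShape
    h12 h13 h22 h41 hKO hFE hPT hp5 hgood hap hsurj (fun f hf => hcertV f hf) (W₀.baseChange ℚ) C hCV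
    ((L.map pl).toFinset) hpT hT hT1 (by rw [hsum, hlen]; omega) (fun hf => hshape hf)

end Shape

/-! ## §2 The row `W = 69150v1` -/

namespace PlusEtaR1FunctionalEquationRows

/-- **(E⁺_η) ∧ (C1⁺_η) at `p = 5` for EVERY tower-onto good supersingular twist of `W = 69150v1` BY THE
FUNCTIONAL-EQUATION SQUEEZE — no height index** (Cremona's minimal model `[1, 0, 0, -13263, 613017]`,
additive `I₀*` at `5`; its minimal `5`-twist `V` has conductor `2766`, good supersingular with `a_5(V) = 0`,
`ρ_{V,5^∞}` onto, `r_an = 1` — the RESIDUE row of crux 19601's census under the valuation squeeze: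
Tamagawa-`5` primes `2:5, 3:10`, `v_an = 2`, `a = 1`, height index `b = 1` open). IN THE KERNEL: `Δ ≠ 0`,
global minimality, the local Tamagawa numbers of `W` at every bad prime (`PlusEtaR1HeightRows.rowCheck_v69150v1`,
seat g10), hence `∑_T ord₅ c_ℓ(W) = 2` on `T = {2, 3}` and the torsion slot `5 ∣ #(X_η/TX_η)_tors`.
DISPLAYED: `rank W(ℚ) ≤ 1`; on `V`: tower onto, the `V`-certificate, and the ANALYTIC SPLIT SHAPE
`L_5⁺(V,η,T) = u·T^{rank W}·(T − c₁)(T − c₂)`, `c₁, c₂ ∈ 5ℤ_5 ∖ {0}` (kit j304242 `feshape`: `μ = 0`,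
`λ = 3`, reduced cofactor `S² + 1 ≡ (S−2)(S+2) (mod 5)`, Hensel: `c₁ ≡ 10, c₂ ≡ 15 (mod 25)`;
convention-independent; `rank W = 1` by GZK at `r_an = 1`, displayed). NAMED FACTS: Kobayashi 1.2/1.3/2.2η/
4.1η, Kitajima–Otsuki 1.3η, B. D. Kim 3.11η (the algebraic functional equation of `X⁺(V/K_∞)^η`), Poitou–Tate.
A per-row instance; nothing booked; `BSD(W,5)` not claimed; the class-wide crux is as open as before.
[cite: KimBD2008MRL, Thm. 3.11 (p. 93)] [cite: Kobayashi2003, §4 Even main conjecture and Thm. 4.1 (p. 8)]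
[cite: KitajimaOtsuki2018, Thm. 1.3] [cite: MilneADT2006, Ch. I, Thm. 4.10] [cite: Cremona1997, Table 1 (label 69150v1)] -/
theorem etaPair_r1_v69150v1_5_of_feShape
    (h12 : Kobayashi2003.thm12_signedSelmerDual_finite_torsion)
    (h13 : Kobayashi2003.thm41_signedCharIdeal_divisibility)
    (h22 : Kobayashi2003.thm22_etaSignedSelmerDual_finite_torsion)
    (h41 : Kobayashi2003.thm41_plusEtaCharIdeal_dvd)
    (hKO : KitajimaOtsuki2018.mainThm13_etaSignedSelmerDual_noFiniteSubmodule)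
    (hFE : Kim2008.thm311_etaSignedSelmerDual_charIdeal_map_invol)
    (hPT : poitouTate_selmerStructure_duality_real ℚ)
    (W : WeierstrassCurve ℚ) (hW : W = ⟨1, 0, 0, (-13263), 613017⟩)
    (hrW : W.mordellWeilRank ≤ 1)
    (V : WeierstrassCurve ℚ) [V.IsElliptic] [V.IsGloballyMinimal] [Fact (5 : ℕ).Prime]
    (C : VariableChange ℚ) (hCV : C • W.quadraticTwist 5 = V)
    (hgood : V.HasGoodReductionAtPrime 5) (hap : V.frobeniusTrace 5 = 0)
    (hsurj : ∀ m : ℕ, V.HasSurjectiveModNGaloisRep (5 ^ m : ℕ))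
    (hcertV : ∀ {N : ℕ} [NeZero N] (f : CuspForm (Gamma0 N) 2), IsNewformOf V f →
      ∃ L : IwasawaAlgebra 5, Kobayashi2003.IsSignedPAdicLFunction f 5 1 L ∧
        IsUnit (PowerSeries.coeff V.mordellWeilRank L))
    (hshape : ∀ {N : ℕ} [NeZero N] {f : CuspForm (Gamma0 N) 2}, IsNewformOf V f →
      ∀ (ϖ : ℚ), (if Even (5 / 2) then (ϖ : ℝ) * V.realPeriodRat = plusPeriod f
          else (ϖ : ℝ) * V.imaginaryPeriodRat = minusPeriod f) →
      ∀ (Lη : IwasawaAlgebra 5), IsQuadraticBranchPlusLFunction f 5 ϖ Lη →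
        ∃ (u : IwasawaAlgebra 5) (c₁ c₂ : ℤ_[5]), IsUnit u ∧ (5 : ℤ_[5]) ∣ c₁ ∧ (5 : ℤ_[5]) ∣ c₂ ∧
          c₁ ≠ 0 ∧ c₂ ≠ 0 ∧
          Lη = u * PowerSeries.X ^ W.mordellWeilRank *
            ((PowerSeries.X - PowerSeries.C c₁) * (PowerSeries.X - PowerSeries.C c₂))) :
    QuadraticBranchPlusEtaLowerInclusionAt V 5 ∧ QuadraticBranchPlusEtaMainConjectureAt V 5 := by
  subst hW
  have hb := IntModelTam.baseChange_rat_mk_int 1 0 0 (-13263) 613017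
  haveI : ((⟨1, 0, 0, (-13263), 613017⟩ : WeierstrassCurve ℤ).baseChange ℚ).IsElliptic :=
    TamLocal.isElliptic_of_rowCheck PlusEtaR1HeightRows.rowCheck_v69150v1
  haveI : ((⟨1, 0, 0, (-13263), 613017⟩ : WeierstrassCurve ℤ).baseChange ℚ).IsGloballyMinimal := by
    rw [hb]; exact PlusEtaR1HeightRows.isGloballyMinimal_v69150v1
  have hD : ((-1 : ℚ) ^ ((5 : ℕ) / 2) * ((5 : ℕ) : ℚ)) = 5 := by norm_num
  have h5 : (5 : ℚ) ≠ 0 := by norm_num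
  -- the rank in the road's currency: `rank V^{(5)} = rank W`
  have hrk : (V.quadraticTwist 5).mordellWeilRank =
      (⟨1, 0, 0, (-13263), 613017⟩ : WeierstrassCurve ℚ).mordellWeilRank :=
    TamagawaRoad.mordellWeilRank_quadraticTwist_eq_of_smul_quadraticTwist_eq h5 hCV
  refine etaPair_of_rowCheck_of_tamagawaPair_of_feShape h12 h13 h22 h41 hKO hFE hPT (le_refl 5)
    PlusEtaR1HeightRows.rowCheck_v69150v1 [2, 3] (by decide) (by decide) (by decide) (by decide) (by decide)
    rfl (hrW := by rw [hb]; exact hrW) V C (by rw [hb, hD]; exact hCV) hgood hap hsurj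
    (fun f hf => hcertV f hf) ?_
  intro N _ f hf ϖ hϖ Lη hL
  rw [hD, hrk]
  exact hshape hf ϖ hϖ Lη hL

end PlusEtaR1FunctionalEquationRows

end Summit.BirchSwinnertonDyer.BirchSwinnertonDyer.Theorems

end
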